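import Summits.Ventures.HodgeRepro2.T5SU11BorelHaarNA

/-!
# The Haar measures of the one-parameter subgroups `A = {a_t}` and `N = {n_s}`: `dt` and `ds`; `borelHaar = (a n)_* (ds ⊗ dt)` — the Haar measure of `B = A ⋉ N` is the product of the Haar measures of `A` and `N`

`t ↦ a_t` and `s ↦ n_s` are closed embeddings `ℝ → SU(1,1)` (`T5SU11HyperbolicSubgroup`,
`T5SU11UnipotentSubgroup`), hence HOMEOMORPHISMS `ℝ ≃ₜ A` and `ℝ ≃ₜ N` onto the subgroups
(`hypHomeomorph`, `unipHomeomorph`) which are group homomorphisms `(ℝ, +) → A, N`. The Lebesgue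
measure transported along such a one-parameter homeomorphism is a Haar measure of the subgroup
(`isHaarMeasure_map_homeomorph`: left-invariance from `dt`'s translation invariance, finiteness on
compacts and positivity on opens through the homeomorphism): `hypHaar = (a_t)_* dt` and
`unipHaar = (n_s)_* ds` are Haar measures of `A` and `N` (`instIsHaarMeasureHypHaar`,
`instIsHaarMeasureUnipHaar`), with `∫_A f = ∫_ℝ f(a_t) dt` and `∫_N f = ∫_ℝ f(n_s) ds` for EVERY `f`
(`integral_hypHaar`, `integral_unipHaar`). Combined with `T5SU11BorelHaarNA.borelHaar_eq_map_prod`: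
**`borelHaar = (n, a) ↦ a n)_* (unipHaar ⊗ hypHaar)`** (`borelHaar_eq_map_prod_haar`) — the left Haar
measure of the semidirect product `B = A ⋉ N` is the product of the Haar measures of `A` and `N`
under the multiplication map `N × A → B`, `(n, a) ↦ a n` — with the Fubini form
`∫_B f = ∫_N ∫_A f(a n) da dn` for integrable `f` (`integral_borelHaar_prod_haar`). Nothing is
claimed about (N).

Blind lane: Mathlib + the HodgeRepro2 prefix only; no sorry; axioms ⊆ {propext, Classical.choice,
Quot.sound}.
-/

namespace Summit.Ventures.HodgeRepro2.T5SU11OneParameterHaar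

open MeasureTheory MeasureTheory.Measure Metric Filter Topology Set Complex
open T5UnitaryBound T5PoincareDensity T5PoincareInvariance T5PoincareMeasure T5SU11Unimodular
  T5SU11Fibration T5SU11FibrationHaar T5SU11Cartan T5SU11OneParameter T5BergmanCoefficient
  T5SU11HyperbolicSubgroup T5SU11UnipotentSubgroup T5SU11BorelSubgroup T5SU11Iwasawa
  T5SU11IwasawaUnique T5SU11BorelTransitive T5SU11IwasawaHaar T5SU11BorelHaar
  T5SU11BorelHaarMeasure T5SU11IwasawaMeasure T5SU11BorelHaarNA
open scoped ENNReal NNReal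

/-! ### Transport of the Lebesgue measure along a one-parameter homeomorphism -/

section transport

variable {S : Type*} [TopologicalSpace S] [MeasurableSpace S] [BorelSpace S]

/-- The Lebesgue measure transported along a homeomorphism `e : ℝ ≃ₜ S` which is a group
homomorphism `(ℝ, +) → S` is left-invariant. -/
theorem isMulLeftInvariant_map_homeomorph [Group S] [MeasurableMul S] (e : ℝ ≃ₜ S)
    (he : ∀ s t, e (s + t) = e s * e t) :
    IsMulLeftInvariant (Measure.map e volume) := by
  refine ⟨fun g => ?_⟩
  obtain ⟨τ, rfl⟩ := e.surjective g
  rw [Measure.map_map (measurable_const_mul _) e.measurable]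
  have h : ((e τ * ·) ∘ ⇑e) = ⇑e ∘ (τ + ·) := funext fun t => by
    simp only [Function.comp_apply, he]
  rw [h, ← Measure.map_map e.measurable (measurable_const_add τ), map_add_left_eq_self]

/-- The transported Lebesgue measure is finite on compact sets. -/
theorem isFiniteMeasureOnCompacts_map_homeomorph (e : ℝ ≃ₜ S) :
    IsFiniteMeasureOnCompacts (Measure.map e volume) := by
  refine ⟨fun K hK => ?_⟩
  rw [e.measurableEmbedding.map_apply]
  exact (e.isCompact_preimage.2 hK).measure_lt_top

/-- The transported Lebesgue measure is positive on non-empty open sets. -/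
theorem isOpenPosMeasure_map_homeomorph (e : ℝ ≃ₜ S) :
    IsOpenPosMeasure (Measure.map e volume) := by
  refine ⟨fun U hU hne => ?_⟩
  rw [e.measurableEmbedding.map_apply]
  exact ((hU.preimage e.continuous).measure_pos volume (hne.preimage e.surjective)).ne'

/-- **Transport**: the Lebesgue measure carried along a homeomorphic one-parameter group
`e : ℝ ≃ₜ S`, `e (s + t) = e s * e t`, is a Haar measure of `S`. -/
theorem isHaarMeasure_map_homeomorph [Group S] [MeasurableMul S] (e : ℝ ≃ₜ S)
    (he : ∀ s t, e (s + t) = e s * e t) : IsHaarMeasure (Measure.map e volume) := by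
  haveI := isFiniteMeasureOnCompacts_map_homeomorph e
  haveI := isOpenPosMeasure_map_homeomorph e
  exact { toIsMulLeftInvariant := isMulLeftInvariant_map_homeomorph e he }

end transport

/-! ### The hyperbolic subgroup `A ≅ ℝ` and its Haar measure `dt` -/

/-- `t ↦ a_t` as a homeomorphism `ℝ ≃ₜ A` (a closed embedding onto its range). -/
noncomputable def hypHomeomorph : ℝ ≃ₜ hypSubgroup :=
  isClosedEmbedding_hyp.isEmbedding.toHomeomorph.trans (Homeomorph.setCongr coe_hypSubgroup.symm)

/-- `hypHomeomorph t = a_t`. -/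
@[simp] lemma coe_hypHomeomorph (t : ℝ) : (hypHomeomorph t : SU11) = hyp t := rfl

/-- `hypHomeomorph` is a group homomorphism `(ℝ, +) → A`. -/
lemma hypHomeomorph_add (s t : ℝ) : hypHomeomorph (s + t) = hypHomeomorph s * hypHomeomorph t :=
  Subtype.ext (by rw [Subgroup.coe_mul, coe_hypHomeomorph, coe_hypHomeomorph, coe_hypHomeomorph,
    hyp_add])

/-- `A` is second countable (homeomorphic to `ℝ`). -/
instance instSecondCountableTopologyHypSubgroup : SecondCountableTopology hypSubgroup :=
  hypHomeomorph.symm.secondCountableTopology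

/-- **The Haar measure of `A = {a_t}`**: the Lebesgue measure `dt` transported along `t ↦ a_t`. -/
noncomputable def hypHaar : Measure hypSubgroup := Measure.map hypHomeomorph volume

/-- **`hypHaar` is a Haar measure of `A`.** -/
instance instIsHaarMeasureHypHaar : IsHaarMeasure hypHaar :=
  isHaarMeasure_map_homeomorph _ hypHomeomorph_add

/-- `hypHaar` is σ-finite. -/
instance instSigmaFiniteHypHaar : SigmaFinite hypHaar :=
  hypHomeomorph.measurableEmbedding.sigmaFinite_map

/-- **`∫_A f = ∫_ℝ f(a_t) dt`** for EVERY `f`. -/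
theorem integral_hypHaar {E : Type*} [NormedAddCommGroup E] [NormedSpace ℝ E]
    (f : hypSubgroup → E) : ∫ a, f a ∂hypHaar = ∫ t : ℝ, f (hypHomeomorph t) :=
  hypHomeomorph.measurableEmbedding.integral_map f

/-- **`∫⁻_A f = ∫⁻_ℝ f(a_t) dt`** for EVERY `f`. -/
theorem lintegral_hypHaar (f : hypSubgroup → ℝ≥0∞) :
    ∫⁻ a, f a ∂hypHaar = ∫⁻ t : ℝ, f (hypHomeomorph t) :=
  hypHomeomorph.measurableEmbedding.lintegral_map f

/-! ### The unipotent subgroup `N ≅ ℝ` and its Haar measure `ds` -/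

/-- `s ↦ n_s` as a homeomorphism `ℝ ≃ₜ N` (a closed embedding onto its range). -/
noncomputable def unipHomeomorph : ℝ ≃ₜ unipSubgroup :=
  isClosedEmbedding_unip.isEmbedding.toHomeomorph.trans (Homeomorph.setCongr coe_unipSubgroup.symm)

/-- `unipHomeomorph s = n_s`. -/
@[simp] lemma coe_unipHomeomorph (s : ℝ) : (unipHomeomorph s : SU11) = unip s := rfl

/-- `unipHomeomorph` is a group homomorphism `(ℝ, +) → N`. -/
lemma unipHomeomorph_add (s t : ℝ) :
    unipHomeomorph (s + t) = unipHomeomorph s * unipHomeomorph t :=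
  Subtype.ext (by rw [Subgroup.coe_mul, coe_unipHomeomorph, coe_unipHomeomorph, coe_unipHomeomorph,
    unip_add])

/-- `N` is second countable (homeomorphic to `ℝ`). -/
instance instSecondCountableTopologyUnipSubgroup : SecondCountableTopology unipSubgroup :=
  unipHomeomorph.symm.secondCountableTopology

/-- **The Haar measure of `N = {n_s}`**: the Lebesgue measure `ds` transported along `s ↦ n_s`. -/
noncomputable def unipHaar : Measure unipSubgroup := Measure.map unipHomeomorph volume

/-- **`unipHaar` is a Haar measure of `N`.** -/
instance instIsHaarMeasureUnipHaar : IsHaarMeasure unipHaar :=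
  isHaarMeasure_map_homeomorph _ unipHomeomorph_add

/-- `unipHaar` is σ-finite. -/
instance instSigmaFiniteUnipHaar : SigmaFinite unipHaar :=
  unipHomeomorph.measurableEmbedding.sigmaFinite_map

/-- **`∫_N f = ∫_ℝ f(n_s) ds`** for EVERY `f`. -/
theorem integral_unipHaar {E : Type*} [NormedAddCommGroup E] [NormedSpace ℝ E]
    (f : unipSubgroup → E) : ∫ n, f n ∂unipHaar = ∫ s : ℝ, f (unipHomeomorph s) :=
  unipHomeomorph.measurableEmbedding.integral_map f

/-- **`∫⁻_N f = ∫⁻_ℝ f(n_s) ds`** for EVERY `f`. -/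
theorem lintegral_unipHaar (f : unipSubgroup → ℝ≥0∞) :
    ∫⁻ n, f n ∂unipHaar = ∫⁻ s : ℝ, f (unipHomeomorph s) :=
  unipHomeomorph.measurableEmbedding.lintegral_map f

/-! ### `borelHaar = (a n)_* (unipHaar ⊗ hypHaar)`: the Haar measure of `B = A ⋉ N` -/

/-- The multiplication map `N × A → B`, `(n, a) ↦ a n`. -/
noncomputable def mulNA (p : unipSubgroup × hypSubgroup) : borelSubgroup :=
  ⟨(p.2 : SU11) * p.1, mul_mem (hypSubgroup_le_borelSubgroup p.2.2)
    (unipSubgroup_le_borelSubgroup p.1.2)⟩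

/-- `mulNA (n, a) = a n`. -/
@[simp] lemma coe_mulNA (p : unipSubgroup × hypSubgroup) :
    (mulNA p : SU11) = (p.2 : SU11) * p.1 := rfl

/-- `mulNA` is continuous. -/
lemma continuous_mulNA : Continuous mulNA :=
  ((continuous_subtype_val.comp continuous_snd).mul
    (continuous_subtype_val.comp continuous_fst)).subtype_mk _

/-- `mulNA` is measurable. -/
lemma measurable_mulNA : Measurable mulNA := continuous_mulNA.measurable

/-- `mulNA ∘ (unipHomeomorph × hypHomeomorph) = mulAN`: `(s, t) ↦ (n_s, a_t) ↦ a_t n_s`. -/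
lemma mulNA_comp_prodMap :
    mulNA ∘ Prod.map (⇑unipHomeomorph) (⇑hypHomeomorph) = mulAN :=
  funext fun _ => Subtype.ext rfl

/-- **`borelHaar = ((n, a) ↦ a n)_* (unipHaar ⊗ hypHaar)`**: the left Haar measure of the semidirect
product `B = A ⋉ N` is the product of the Haar measures `ds` of `N` and `dt` of `A`. -/
theorem borelHaar_eq_map_prod_haar :
    borelHaar = Measure.map mulNA (unipHaar.prod hypHaar) := by
  rw [borelHaar_eq_map_prod, unipHaar, hypHaar,
    Measure.map_prod_map _ _ unipHomeomorph.measurable hypHomeomorph.measurable,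
    Measure.map_map measurable_mulNA (unipHomeomorph.measurable.prodMap hypHomeomorph.measurable),
    mulNA_comp_prodMap]
  rfl

/-- `mulNA` is a measurable embedding `N × A → B` (it is `mulAN` composed with the inverse
homeomorphisms). -/
lemma measurableEmbedding_mulNA : MeasurableEmbedding mulNA := by
  have h : mulNA = mulAN ∘ Prod.map (⇑unipHomeomorph.symm) (⇑hypHomeomorph.symm) := by
    funext p
    obtain ⟨n, a⟩ := p
    apply Subtype.ext
    show (a : SU11) * n = hyp (hypHomeomorph.symm a) * unip (unipHomeomorph.symm n)
    rw [← coe_hypHomeomorph, ← coe_unipHomeomorph, Homeomorph.apply_symm_apply,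
      Homeomorph.apply_symm_apply]
  rw [h]
  exact measurableEmbedding_mulAN.comp
    (unipHomeomorph.symm.prodCongr hypHomeomorph.symm).measurableEmbedding

/-- **`∫_B f = ∫_{N × A} f(a n) d(unipHaar ⊗ hypHaar)`** for EVERY `f`. -/
theorem integral_borelHaar_prod_haar' {E : Type*} [NormedAddCommGroup E] [NormedSpace ℝ E]
    (f : borelSubgroup → E) :
    ∫ b, f b ∂borelHaar = ∫ p, f (mulNA p) ∂(unipHaar.prod hypHaar) := by
  rw [borelHaar_eq_map_prod_haar, measurableEmbedding_mulNA.integral_map]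

/-- **`∫_B f = ∫_N ∫_A f(a n) da dn`** for `borelHaar`-integrable `f` (Fubini over
`N × A`). -/
theorem integral_borelHaar_prod_haar {E : Type*} [NormedAddCommGroup E] [NormedSpace ℝ E]
    [CompleteSpace E] (f : borelSubgroup → E) (hf : Integrable f borelHaar) :
    ∫ b, f b ∂borelHaar = ∫ n, ∫ a, f (mulNA (n, a)) ∂hypHaar ∂unipHaar := by
  rw [integral_borelHaar_prod_haar']
  have hf' : Integrable (f ∘ mulNA) (unipHaar.prod hypHaar) := by
    rw [← measurableEmbedding_mulNA.integrable_map_iff, ← borelHaar_eq_map_prod_haar]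
    exact hf
  exact integral_prod (fun p => f (mulNA p)) hf'

end Summit.Ventures.HodgeRepro2.T5SU11OneParameterHaar
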